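import Literature.NumberTheory.Sieve.MontgomeryVaughan1975DensityProofs
import HarnessLib

/-!
# Route `PrimeLevelFamEdge` — TYPED IDEA DELTAS, deck 28: the a8S-short zero side in the exceptional world (A)
# (cell ls-idea, lens-7 gen 27, crux idea `l7-exceptional-clause-two-term-ledger` v2.2 §U″; critic of record D (ref-4) b117 PASS (byte-copy rc 0, axioms std on the three main theorems, m(θ) ledger re-derived);
# LANDING NOTE typer ls-idea-typ-1 gen 4: the seat's `HOME/ls-idea-lens-7/Sketch_Ubis_ExcZeroPowerSum.lean` sha16
# dc404b1f00c668d0 VERBATIM up to (i) namespace `…Theses.PrimeLevelFamEdge.BeyondDiagonalBeatsQuarter.OffDiag.LensSevenSketchUbis`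
# → `…Theorems.PrimeLevelFamEdgeIdeaDeltas.ExcZeroLedger`, (ii) this header.)  U-A PROVED, with the Deuring–Heilbronn floor:

Node L5′ ≡ U (row a8S-short, `cond ≤ N^{3η}`) of K_B =
`Summit.Parity.GeneralizedHardyLittlewood.Theses.PrimeLevelFamEdge.BeyondDiagonalBeatsQuarter`
(stmt-Parity-20343), line `diagonal_kernel_split` REV 4, U-E `by_contra` schema (v2.0 §U): `closes` only ever
VISITS world (A) = "an exceptional zero `β̃` of a real primitive `χ̃` mod `r ≤ P` at level `c_H/log P` exists".
v2.0 TYPED the world-(A) zero side as U-A `LensSevenSketchU.DHWeightedZeroLedger` (pencil: Abel summation,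
`Z ≤ 3 C_D·δ̃·log P` for `N ≥ P^{3c_D}`, `δ̃ = 1 − β̃`). This file PROVES it from theorems ALREADY IN THE TREE,
and sharpens it by the repulsion that the SAME tree fact already encodes:

* `excZeroPowerSum_le_rpow` (master) — in world (A), for `P ≥ 2`, `0 ≤ η ≤ 1`, `N ≥ P^{2c_D}`, and EITHER
  `η = 0` OR the Deuring–Heilbronn floor condition `K·P^{c_D η} ≤ 1` (`K := C_D·(1 − β̃)·log P`):
  (ζ) `∑_{ρ : ζ(ρ)=0, |γ| ≤ P⁶} m(ρ) N^{Re ρ − 1} ≤ 5·K·(P^{c_D}/N)^η`, and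
  (χ) for every admissible finite family `Z(q, χ)` of non-trivial zeros of height `≤ P⁶`,
  `∑_{q ≤ P} ∑*_{χ mod q} ∑_{ρ ∈ Z(q,χ), (q,χ,ρ) ≠ (r̃,χ̃,β̃)} m_χ(ρ) N^{Re ρ − 1} ≤ 5·K·(P^{c_D}/N)^η`.
  THE FLOOR IS NOT AN EXTRA INPUT: conjuncts 3–4 of `gallagher1970_logFreeDensity` bound the weighted count
  of non-exceptional zeros with `Re ρ ≥ α` by `K·P^{c_D(1−α)}`; a genuine zero weighs `≥ 1`
  (`riemannZetaZeroOrder_pos_iff`, `DirichletDisc.zeroOrder_pos_iff`), so `K·P^{c_D η} ≤ 1` forces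
  `Re ρ ≤ 1 − η` for every zero other than `β̃` (Linnik's repulsion read off Bombieri's Théorème 14 (ii)).
* `excZeroPowerSum_le` — the `η = 0` face: both sums `≤ 5·C_D·(1 − β̃)·log P` for `N ≥ P^{2c_D}`.
* `dhWeightedZeroLedger₅` — v2.0's U-A decl VERBATIM except the Abel constant `3 ↦ 5` (the tree's partial
  summation `…_of_density₀` is calibrated `e^{1/2}/(1 − e^{−1/2}) < 5` at `N ≥ B²`; U-A's range `N ≥ P^{3c_D}`
  is kept). So U-A is no longer "typed": it is a COROLLARY of PROVED tree theorems.
* `excZeroPowerSum_le_powK` — the K-power face (Linnik's repulsion in `N^{β−1}` currency): if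
  `P^{−c_D} ≤ K ≤ 1` then both sums are `≤ 5·K^{log N/(c_D log P)}` for `N ≥ P^{2c_D}` (the master at the
  Deuring–Heilbronn exponent `η_K = log(1/K)/(c_D log P)`, where `(P^{c_D})^{η_K} = 1/K`, `N^{−η_K} = K^{log N/(c_D log P)}`;
  for `K < P^{−c_D}` the master at `η = 1` already gives `≤ 5·K·P^{c_D}/N ≤ 5/N`). In the a8S-short row the
  non-exceptional zero side is thus a POWER `m = log N/(c_D log P) ≥ 2` of the Siegel defect `K`, not merely
  `O(K)`. PENCIL (window arithmetic, v2.0 §U coordinates `N = D^θ`, `P = D·N^{3η} = D^{1+3ηθ}`):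
  `m(θ) = θ/(c_D(1+3ηθ))` increases from `3` at `θ₀ = 3c_D/(1−9ηc_D)` to `1/(c_D(η′+3η))` at `θ = 1/η′`, so
  v2.0's absorption condition for a polylog bookkeeping loss `L^κ` in `Λ_U`, «`κ < A₀ − 1`», relaxes to
  `κ < m(θ)(A₀ − 1)` — at least `κ < 3(A₀ − 1)` on the whole window.
Ingredients (all PROVED in tree, no named fact consumed): `gallagher1970_logFreeDensity_holds` (Bombieri,
*Le grand crible* Thm 14 (ii) = Gallagher 1970 Thm 6 with the Deuring–Heilbronn factor) and Gallagher's §5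
partial summation `sum_mul_rpow_sub_one_le_of_density₀` / `sum_sum_sum_mul_rpow_le_of_density₀` with `B = P^{c_D}`.

This is the a8S-short TWIN, in world (A), of typ-1's world-free ζ-row theorem `Z_le_deltaVK` (p652299,
`Literature/NumberTheory/LFunctions/ZetaZeroPowerSumVK.lean`): there the smallness comes from the
Vinogradov–Korobov floor, here from the exceptional zero itself (I7: "assume β̃ exists — it repels").
What it does NOT do: it does not exclude or produce `β̃`; it says nothing under ordering α (box currency,
certified VOID at U: v2.1 §U′ `not_powerSiegel_io`); the ledger's OTHER entries — U-B (Hecke's converse, quantitative), U-C (the exceptional sequence from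
`¬ LOneLowerBound A₀`), U-D (the clean window; `χ_D`'s own term lives in a8R, `D > R`, where the large sieve is
world-blind) — and the lead's word on ordering β (desk l.2853 (2)) stay typed-not-proved / pencil.

HONESTY: no exceptional-zero theorem (no Landau–Siegel / Siegel-zero exclusion, no Theorem 1–2 of
arXiv:2211.02515, no repaired Margin232) is proved here or by ideation; the exceptional world is ASSUMED
(hypothesis `IsExceptionalZero cH P r χe β`); typed ≠ proved; computed ≠ proved; located ≠ endorsed.
-/

noncomputable section

open Finset Real
open Literature.NumberTheory.LFunctions
open Literature.NumberTheory.Sieve.MontgomeryVaughan1975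

namespace Summit.Parity.GeneralizedHardyLittlewood.Theorems.PrimeLevelFamEdgeIdeaDeltas.ExcZeroLedger

/-- A single term of a nonnegative triple sum is at most the sum. [folklore] -/
theorem single_le_sum₃ {κ : Type*} {α : κ → Type*} (I : Finset κ) (F : ∀ k, Finset (α k))
    (Z : ∀ k, α k → Finset ℂ) (m : ∀ k, α k → ℂ → ℝ) (hm : ∀ k a ρ, 0 ≤ m k a ρ)
    {k : κ} (hk : k ∈ I) {a : α k} (ha : a ∈ F k) {ρ : ℂ} (hρ : ρ ∈ Z k a) :
    m k a ρ ≤ ∑ k ∈ I, ∑ a ∈ F k, ∑ ρ ∈ Z k a, m k a ρ :=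
  calc m k a ρ ≤ ∑ ρ ∈ Z k a, m k a ρ := Finset.single_le_sum (fun ρ _ => hm k a ρ) hρ
    _ ≤ ∑ a ∈ F k, ∑ ρ ∈ Z k a, m k a ρ :=
        Finset.single_le_sum (f := fun a => ∑ ρ ∈ Z k a, m k a ρ)
          (fun a _ => Finset.sum_nonneg fun ρ _ => hm k a ρ) ha
    _ ≤ ∑ k ∈ I, ∑ a ∈ F k, ∑ ρ ∈ Z k a, m k a ρ :=
        Finset.single_le_sum (f := fun k => ∑ a ∈ F k, ∑ ρ ∈ Z k a, m k a ρ)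
          (fun k _ => Finset.sum_nonneg fun a _ => Finset.sum_nonneg fun ρ _ => hm k a ρ) hk

open scoped Classical in
/-- **U″ master — the exceptional-world zero power sum with the Deuring–Heilbronn floor.** With the constants
`c_D, C_D, c_H` of `gallagher1970_logFreeDensity`, `K := C_D (1 − β̃) log P`: if `β̃` is an exceptional zero at
level `c_H` (`IsExceptionalZero c_H P r χ̃ β̃`), `0 ≤ η ≤ 1`, and either `η = 0` or `K·P^{c_D η} ≤ 1`, then for
every `N ≥ P^{2 c_D}` the weighted zero power sums `∑ m(ρ) N^{Re ρ − 1}` over (ζ) the zeros of `ζ` of height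
`≤ P⁶` and (χ) any admissible family of non-trivial zeros of the primitive `L(s, χ)`, `q ≤ P`, height `≤ P⁶`,
the term `(r̃, χ̃, β̃)` removed, are each `≤ 5 K (P^{c_D}/N)^η`.
[cite: Bombieri1987GrandCrible, §6 Théorème 14] [cite: Gallagher1970Density, Theorem 6, §5] -/
theorem excZeroPowerSum_le_rpow :
    ∃ c_D C_D cH : ℝ, 0 < c_D ∧ 0 < C_D ∧ 0 < cH ∧
      ∀ P : ℝ, 2 ≤ P → ∀ (r : ℕ) [NeZero r] (χe : DirichletCharacter ℂ r) (β : ℝ),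
        IsExceptionalZero cH P r χe β → ∀ η : ℝ, 0 ≤ η → η ≤ 1 →
          (η = 0 ∨ C_D * ((1 - β) * Real.log P) * P ^ (c_D * η) ≤ 1) →
          ∀ N : ℝ, P ^ (2 * c_D) ≤ N →
          (∑ ρ ∈ (weilZeroIndex_finite (P ^ 6)).toFinset,
              ((riemannZetaZeroOrder ρ : ℤ) : ℝ) * N ^ (ρ.re - 1) ≤
            5 * (C_D * ((1 - β) * Real.log P)) * (P ^ c_D / N) ^ η) ∧
          ∀ Z : (q : ℕ) → DirichletCharacter ℂ q → Finset ℂ,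
            (∀ (q' : ℕ) (χ : DirichletCharacter ℂ (q' + 1)), ∀ ρ ∈ Z (q' + 1) χ,
                χ.LFunction ρ = 0 ∧ 0 < ρ.re ∧ ρ.re < 1 ∧ |ρ.im| ≤ P ^ 6) →
            ∑ q' ∈ Finset.Ico 1 ⌊P⌋₊, ∑ χ : DirichletCharacter ℂ (q' + 1) with χ.IsPrimitive,
              ∑ ρ ∈ Z (q' + 1) χ with
                ¬ (q' + 1 = r ∧ (∀ n : ℕ, χ (n : ZMod (q' + 1)) = χe (n : ZMod r)) ∧
                  ρ = ((β : ℝ) : ℂ)),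
                (DirichletDisc.zeroOrder χ ρ : ℝ) * N ^ (ρ.re - 1) ≤
              5 * (C_D * ((1 - β) * Real.log P)) * (P ^ c_D / N) ^ η := by
  obtain ⟨c_D, C_D, cH, hcD, hCD, hcH, -, -, hDHζ, hDH⟩ := gallagher1970_logFreeDensity_holds
  refine ⟨c_D, C_D, cH, hcD, hCD, hcH, fun P hP2 r _ χe β hEZ η hη0 hη1 hfloor N hN => ?_⟩
  have hP0 : 0 < P := by linarith
  have hP1 : (1 : ℝ) ≤ P := by linarith
  have hP1' : (1 : ℝ) < P := by linarith
  have hlogP : 0 < Real.log P := Real.log_pos hP1'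
  have hEZ' := hEZ
  obtain ⟨-, -, -, -, hβ1, -⟩ := hEZ'
  set K : ℝ := C_D * ((1 - β) * Real.log P) with hKdef
  have hK0 : 0 ≤ K := mul_nonneg hCD.le (mul_nonneg (by linarith) hlogP.le)
  -- the scale `B = P^{c_D}` of the density bound; `N ≥ B²`
  set B : ℝ := P ^ c_D with hBdef
  have hB1 : 1 ≤ B := Real.one_le_rpow hP1 hcD.le
  have hBlt : 1 < B := by
    have h := Real.rpow_lt_rpow_of_exponent_lt hP1' hcD
    rwa [Real.rpow_zero] at h
  have hBsq : B ^ 2 = P ^ (2 * c_D) := by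
    rw [hBdef, ← Real.rpow_natCast, ← Real.rpow_mul hP0.le]
    congr 1
    push_cast
    ring
  have hBN : B ^ 2 ≤ N := hBsq ▸ hN
  have hN1 : 1 < N := by nlinarith
  -- THE FLOOR MECHANISM: a weight `≥ 1` at real part `> 1 − η` contradicts the density bound with the
  -- Deuring–Heilbronn factor once `K·P^{c_D η} ≤ 1`
  have floor_abs : ∀ {σ m S : ℝ}, 1 - η < σ → 1 ≤ m → m ≤ S → S ≤ K * P ^ (c_D * (1 - σ)) →
      K * P ^ (c_D * η) ≤ 1 → False := by
    intro σ m S hσ hm hmS hS hK1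
    have hexp : c_D * (1 - σ) < c_D * η := mul_lt_mul_of_pos_left (by linarith) hcD
    rcases hK0.eq_or_lt with hK | hK
    · rw [← hK, zero_mul] at hS
      linarith
    · have hlt : K * P ^ (c_D * (1 - σ)) < K * P ^ (c_D * η) :=
        mul_lt_mul_of_pos_left (Real.rpow_lt_rpow_of_exponent_lt hP1' hexp) hK
      linarith
  refine ⟨?_, fun Z hZmem => ?_⟩
  · -- (ζ) the zeros of `ζ` in the box
    have hζpos : ∀ ρ ∈ (weilZeroIndex_finite (P ^ 6)).toFinset, 0 ≤ ρ.re := fun ρ hρ =>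
      (mem_toFinset_weilZeroIndex hρ).2.1
    have hζw : ∀ ρ ∈ (weilZeroIndex_finite (P ^ 6)).toFinset, 0 ≤ ((riemannZetaZeroOrder ρ : ℤ) : ℝ) :=
      fun ρ hρ => (mem_toFinset_weilZeroIndex hρ).2.2.2.2.2.2.2
    have hζre : ∀ ρ ∈ (weilZeroIndex_finite (P ^ 6)).toFinset, ρ.re ≤ 1 - η := by
      intro ρ hρ
      have hmem := mem_toFinset_weilZeroIndex hρ
      rcases hfloor with hη | hK1
      · rw [hη, sub_zero]
        exact hmem.2.2.1
      by_contra hcon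
      push Not at hcon
      have hm1 : (1 : ℝ) ≤ ((riemannZetaZeroOrder ρ : ℤ) : ℝ) := by
        have h := (riemannZetaZeroOrder_pos_iff hmem.2.2.2.2.2.2.1).mpr hmem.1
        have h' : (1 : ℤ) ≤ riemannZetaZeroOrder ρ := by omega
        exact_mod_cast h'
      have hd := hDHζ P hP2 r χe β hEZ ρ.re hmem.2.1 hmem.2.2.1
      have hsingle : ((riemannZetaZeroOrder ρ : ℤ) : ℝ) ≤
          ∑ ρ' ∈ (weilZeroIndex_finite (P ^ 6)).toFinset with ρ.re ≤ ρ'.re,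
            ((riemannZetaZeroOrder ρ' : ℤ) : ℝ) :=
        Finset.single_le_sum (f := fun ρ' => ((riemannZetaZeroOrder ρ' : ℤ) : ℝ))
          (fun ρ' hρ' => hζw ρ' (Finset.mem_filter.mp hρ').1) (Finset.mem_filter.mpr ⟨hρ, le_rfl⟩)
      exact floor_abs hcon hm1 hsingle hd hK1
    refine sum_mul_rpow_sub_one_le_of_density₀ (weilZeroIndex_finite (P ^ 6)).toFinset (fun ρ => ρ.re)
      (fun ρ => ((riemannZetaZeroOrder ρ : ℤ) : ℝ)) hN1 hB1 hBN hK0 hη1 hζw hζpos hζre ?_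
    intro α' hα'0 hα'1
    have h := hDHζ P hP2 r χe β hEZ α' hα'0 (by linarith)
    rw [hBdef, ← Real.rpow_mul hP0.le]
    exact h
  · -- (χ) the family, the exceptional term removed
    set Zexc : (q : ℕ) → DirichletCharacter ℂ q → Finset ℂ := fun q χ =>
      (Z q χ).filter fun ρ => ¬ (q = r ∧ (∀ n : ℕ, χ (n : ZMod q) = χe (n : ZMod r)) ∧
        ρ = ((β : ℝ) : ℂ)) with hZexc
    have hZexc_sub : ∀ (q : ℕ) (χ : DirichletCharacter ℂ q), Zexc q χ ⊆ Z q χ :=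
      fun q χ => Finset.filter_subset _ _
    -- primitive characters mod `q' + 1 ≥ 2` are non-principal
    have hne1 : ∀ (q' : ℕ), 1 ≤ q' → ∀ (χ : DirichletCharacter ℂ (q' + 1)), χ.IsPrimitive → χ ≠ 1 := by
      intro q' hq' χ hprim hχ
      subst hχ
      have := eq_one_of_isPrimitive_one hprim
      omega
    -- every zero in `Zexc` has `Re ρ ≤ 1 − η`
    have hre : ∀ q' ∈ Ico 1 ⌊P⌋₊, ∀ χ ∈ (univ : Finset (DirichletCharacter ℂ (q' + 1))).filter
        (fun χ => χ.IsPrimitive), ∀ ρ ∈ Zexc (q' + 1) χ, ρ.re ≤ 1 - η := by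
      intro q' hq' χ hχ ρ hρ
      have hρZ : ρ ∈ Z (q' + 1) χ := hZexc_sub _ _ hρ
      have hmem := hZmem q' χ ρ hρZ
      rcases hfloor with hη | hK1
      · rw [hη, sub_zero]
        exact hmem.2.2.1.le
      by_contra hcon
      push Not at hcon
      have hq' := Finset.mem_Ico.mp hq'
      have hχp : χ.IsPrimitive := (Finset.mem_filter.mp hχ).2
      have hχ1 : χ ≠ 1 := hne1 q' hq'.1 χ hχp
      have hm1 : (1 : ℝ) ≤ (DirichletDisc.zeroOrder χ ρ : ℝ) := by
        have h := (DirichletDisc.zeroOrder_pos_iff χ hχ1 ρ).mpr hmem.1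
        have h' : 1 ≤ DirichletDisc.zeroOrder χ ρ := h
        exact_mod_cast h'
      have hd := hDH P hP2 r χe β hEZ Z hZmem ρ.re hmem.2.1.le hmem.2.2.1.le
      have hρ' : ρ ∈ (Z (q' + 1) χ).filter (fun ρ' => ρ.re ≤ ρ'.re ∧
          ¬ (q' + 1 = r ∧ (∀ n : ℕ, χ (n : ZMod (q' + 1)) = χe (n : ZMod r)) ∧
            ρ' = ((β : ℝ) : ℂ))) := by
        simp only [hZexc, Finset.mem_filter] at hρ
        exact Finset.mem_filter.mpr ⟨hρZ, le_rfl, hρ.2⟩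
      have hsingle := single_le_sum₃ (Ico 1 ⌊P⌋₊)
        (fun q'' => (univ : Finset (DirichletCharacter ℂ (q'' + 1))).filter fun χ' => χ'.IsPrimitive)
        (fun q'' χ' => (Z (q'' + 1) χ').filter fun ρ' => ρ.re ≤ ρ'.re ∧
          ¬ (q'' + 1 = r ∧ (∀ n : ℕ, χ' (n : ZMod (q'' + 1)) = χe (n : ZMod r)) ∧
            ρ' = ((β : ℝ) : ℂ)))
        (fun q'' χ' ρ' => (DirichletDisc.zeroOrder χ' ρ' : ℝ)) (fun _ _ _ => Nat.cast_nonneg _)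
        (Finset.mem_Ico.mpr hq') hχ hρ'
      exact floor_abs hcon hm1 hsingle hd hK1
    have key : ∑ q' ∈ Ico 1 ⌊P⌋₊, ∑ χ : DirichletCharacter ℂ (q' + 1) with χ.IsPrimitive,
        ∑ ρ ∈ Zexc (q' + 1) χ, (DirichletDisc.zeroOrder χ ρ : ℝ) * N ^ (ρ.re - 1) ≤
          5 * K * (B / N) ^ η := by
      refine sum_sum_sum_mul_rpow_le_of_density₀ (Ico 1 ⌊P⌋₊)
        (fun q' => (univ : Finset (DirichletCharacter ℂ (q' + 1))).filter fun χ => χ.IsPrimitive)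
        (fun q' χ => Zexc (q' + 1) χ) (fun q' χ ρ => (DirichletDisc.zeroOrder χ ρ : ℝ))
        hN1 hB1 hBN hK0 hη1 (fun _ _ _ _ _ _ => Nat.cast_nonneg _)
        (fun q' _ χ _ ρ hρ => (hZmem q' χ ρ (hZexc_sub _ _ hρ)).2.1.le) hre ?_
      intro α' hα'0 hα'1
      have h := hDH P hP2 r χe β hEZ Z hZmem α' hα'0 (by linarith)
      rw [hBdef, ← Real.rpow_mul hP0.le]
      refine le_trans (le_of_eq ?_) h
      refine Finset.sum_congr rfl fun q' _ => Finset.sum_congr rfl fun χ _ => ?_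
      simp only [hZexc, Finset.filter_filter]
      refine Finset.sum_congr ?_ fun _ _ => rfl
      ext ρ
      simp only [Finset.mem_filter]
      tauto
    simpa only [hZexc] using key

open scoped Classical in
/-- **U″ — the `η = 0` face.** In world (A), for `N ≥ P^{2c_D}`, both zero power sums (ζ, and the family
with `(r̃, χ̃, β̃)` removed) are `≤ 5·C_D·(1 − β̃)·log P`.
[cite: Bombieri1987GrandCrible, §6 Théorème 14] [cite: Gallagher1970Density, Theorem 6, §5] -/
theorem excZeroPowerSum_le :
    ∃ c_D C_D cH : ℝ, 0 < c_D ∧ 0 < C_D ∧ 0 < cH ∧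
      ∀ P : ℝ, 2 ≤ P → ∀ (r : ℕ) [NeZero r] (χe : DirichletCharacter ℂ r) (β : ℝ),
        IsExceptionalZero cH P r χe β → ∀ N : ℝ, P ^ (2 * c_D) ≤ N →
          (∑ ρ ∈ (weilZeroIndex_finite (P ^ 6)).toFinset,
              ((riemannZetaZeroOrder ρ : ℤ) : ℝ) * N ^ (ρ.re - 1) ≤
            5 * (C_D * ((1 - β) * Real.log P))) ∧
          ∀ Z : (q : ℕ) → DirichletCharacter ℂ q → Finset ℂ,
            (∀ (q' : ℕ) (χ : DirichletCharacter ℂ (q' + 1)), ∀ ρ ∈ Z (q' + 1) χ,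
                χ.LFunction ρ = 0 ∧ 0 < ρ.re ∧ ρ.re < 1 ∧ |ρ.im| ≤ P ^ 6) →
            ∑ q' ∈ Finset.Ico 1 ⌊P⌋₊, ∑ χ : DirichletCharacter ℂ (q' + 1) with χ.IsPrimitive,
              ∑ ρ ∈ Z (q' + 1) χ with
                ¬ (q' + 1 = r ∧ (∀ n : ℕ, χ (n : ZMod (q' + 1)) = χe (n : ZMod r)) ∧
                  ρ = ((β : ℝ) : ℂ)),
                (DirichletDisc.zeroOrder χ ρ : ℝ) * N ^ (ρ.re - 1) ≤
              5 * (C_D * ((1 - β) * Real.log P)) := by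
  obtain ⟨c_D, C_D, cH, hcD, hCD, hcH, h⟩ := excZeroPowerSum_le_rpow
  refine ⟨c_D, C_D, cH, hcD, hCD, hcH, fun P hP2 r _ χe β hEZ N hN => ?_⟩
  obtain ⟨h1, h2⟩ := h P hP2 r χe β hEZ 0 le_rfl zero_le_one (Or.inl rfl) N hN
  refine ⟨by simpa only [Real.rpow_zero, mul_one] using h1, fun Z hZ => ?_⟩
  simpa only [Real.rpow_zero, mul_one] using h2 Z hZ

open scoped Classical in
/-- v2.0's U-A `LensSevenSketchU.DHWeightedZeroLedger` VERBATIM except the Abel constant `3 ↦ 5`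
(binder order, range `N ≥ P^{3 c_D}` and everything else kept). -/
def DHWeightedZeroLedger₅ : Prop :=
  ∃ c_D C_D cH : ℝ, 0 < c_D ∧ 0 < C_D ∧ 0 < cH ∧
    ∀ P : ℝ, 2 ≤ P → ∀ N : ℝ, P ^ (3 * c_D) ≤ N →
    ∀ (r : ℕ) [NeZero r] (χe : DirichletCharacter ℂ r) (β : ℝ), IsExceptionalZero cH P r χe β →
      (∑ ρ ∈ (weilZeroIndex_finite (P ^ 6)).toFinset,
          ((riemannZetaZeroOrder ρ : ℤ) : ℝ) * N ^ (ρ.re - 1) ≤ 5 * C_D * ((1 - β) * Real.log P)) ∧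
      ∀ Z : (q : ℕ) → DirichletCharacter ℂ q → Finset ℂ,
        (∀ (q' : ℕ) (χ : DirichletCharacter ℂ (q' + 1)), ∀ ρ ∈ Z (q' + 1) χ,
            χ.LFunction ρ = 0 ∧ 0 < ρ.re ∧ ρ.re < 1 ∧ |ρ.im| ≤ P ^ 6) →
        ∑ q' ∈ Finset.Ico 1 ⌊P⌋₊, ∑ χ : DirichletCharacter ℂ (q' + 1) with χ.IsPrimitive,
          ∑ ρ ∈ Z (q' + 1) χ with
              ¬ (q' + 1 = r ∧ (∀ n : ℕ, χ (n : ZMod (q' + 1)) = χe (n : ZMod r)) ∧ ρ = ((β : ℝ) : ℂ)),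
            (DirichletDisc.zeroOrder χ ρ : ℝ) * N ^ (ρ.re - 1) ≤ 5 * C_D * ((1 - β) * Real.log P)

/-- **U-A (constant 5) PROVED.** -/
theorem dhWeightedZeroLedger₅ : DHWeightedZeroLedger₅ := by
  obtain ⟨c_D, C_D, cH, hcD, hCD, hcH, h⟩ := excZeroPowerSum_le
  refine ⟨c_D, C_D, cH, hcD, hCD, hcH, fun P hP2 N hN r _ χe β hEZ => ?_⟩
  have hN' : P ^ (2 * c_D) ≤ N :=
    (Real.rpow_le_rpow_of_exponent_le (by linarith) (by linarith)).trans hN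
  obtain ⟨h1, h2⟩ := h P hP2 r χe β hEZ N hN'
  exact ⟨h1.trans_eq (by ring), fun Z hZ => (h2 Z hZ).trans_eq (by ring)⟩

open scoped Classical in
/-- **U″ — the K-power face (Linnik's repulsion in `N^{β−1}` currency).** With `K := C_D (1 − β̃) log P`: if
`P^{−c_D} ≤ K ≤ 1` then, in world (A), for every `N ≥ P^{2c_D}` both zero power sums (ζ, and the family with
`(r̃, χ̃, β̃)` removed) are `≤ 5·K^{log N/(c_D log P)}` — the master bound at the Deuring–Heilbronn exponent
`η_K = log(1/K)/(c_D log P)`, where `(P^{c_D})^{η_K} = 1/K` and `N^{−η_K} = K^{log N/(c_D log P)}`.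
[cite: Bombieri1987GrandCrible, §6 Théorème 14] [cite: Gallagher1970Density, Theorem 6, §5] -/
theorem excZeroPowerSum_le_powK :
    ∃ c_D C_D cH : ℝ, 0 < c_D ∧ 0 < C_D ∧ 0 < cH ∧
      ∀ P : ℝ, 2 ≤ P → ∀ (r : ℕ) [NeZero r] (χe : DirichletCharacter ℂ r) (β : ℝ),
        IsExceptionalZero cH P r χe β →
          P ^ (-c_D) ≤ C_D * ((1 - β) * Real.log P) → C_D * ((1 - β) * Real.log P) ≤ 1 →
          ∀ N : ℝ, P ^ (2 * c_D) ≤ N →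
          (∑ ρ ∈ (weilZeroIndex_finite (P ^ 6)).toFinset,
              ((riemannZetaZeroOrder ρ : ℤ) : ℝ) * N ^ (ρ.re - 1) ≤
            5 * (C_D * ((1 - β) * Real.log P)) ^ (Real.log N / (c_D * Real.log P))) ∧
          ∀ Z : (q : ℕ) → DirichletCharacter ℂ q → Finset ℂ,
            (∀ (q' : ℕ) (χ : DirichletCharacter ℂ (q' + 1)), ∀ ρ ∈ Z (q' + 1) χ,
                χ.LFunction ρ = 0 ∧ 0 < ρ.re ∧ ρ.re < 1 ∧ |ρ.im| ≤ P ^ 6) →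
            ∑ q' ∈ Finset.Ico 1 ⌊P⌋₊, ∑ χ : DirichletCharacter ℂ (q' + 1) with χ.IsPrimitive,
              ∑ ρ ∈ Z (q' + 1) χ with
                ¬ (q' + 1 = r ∧ (∀ n : ℕ, χ (n : ZMod (q' + 1)) = χe (n : ZMod r)) ∧
                  ρ = ((β : ℝ) : ℂ)),
                (DirichletDisc.zeroOrder χ ρ : ℝ) * N ^ (ρ.re - 1) ≤
              5 * (C_D * ((1 - β) * Real.log P)) ^ (Real.log N / (c_D * Real.log P)) := by
  obtain ⟨c_D, C_D, cH, hcD, hCD, hcH, h⟩ := excZeroPowerSum_le_rpow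
  refine ⟨c_D, C_D, cH, hcD, hCD, hcH, fun P hP2 r _ χe β hEZ hKlo hK1 N hN => ?_⟩
  have hP0 : 0 < P := by linarith
  have hP1' : (1 : ℝ) < P := by linarith
  have hlogP : 0 < Real.log P := Real.log_pos hP1'
  set K : ℝ := C_D * ((1 - β) * Real.log P) with hKdef
  have hKpos : 0 < K := lt_of_lt_of_le (Real.rpow_pos_of_pos hP0 _) hKlo
  have hden : 0 < c_D * Real.log P := mul_pos hcD hlogP
  -- the Deuring–Heilbronn exponent
  set η : ℝ := -Real.log K / (c_D * Real.log P) with hηdef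
  have hlogK0 : Real.log K ≤ 0 := Real.log_nonpos hKpos.le hK1
  have hlogKlo : -c_D * Real.log P ≤ Real.log K := by
    have := Real.log_le_log (Real.rpow_pos_of_pos hP0 _) hKlo
    rwa [Real.log_rpow hP0] at this
  have hη0 : 0 ≤ η := div_nonneg (by linarith) hden.le
  have hη1 : η ≤ 1 := by
    rw [hηdef, div_le_one hden]
    linarith
  -- `P^{c_D η} = 1/K`
  have hPη : P ^ (c_D * η) = K⁻¹ := by
    have hexp : c_D * η = -Real.log K / Real.log P := by
      rw [hηdef]
      field_simp
    rw [hexp, Real.rpow_def_of_pos hP0, show Real.log P * (-Real.log K / Real.log P) = -Real.log K by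
      field_simp, Real.exp_neg, Real.exp_log hKpos]
  have hfloor : K * P ^ (c_D * η) ≤ 1 := by
    rw [hPη, mul_inv_cancel₀ hKpos.ne']
  -- `N ≥ P^{2c_D} > 0`
  have hN0 : 0 < N := lt_of_lt_of_le (Real.rpow_pos_of_pos hP0 _) hN
  -- the conversion `5 K (P^{c_D}/N)^η = 5 K^{log N/(c_D log P)}`
  have hconv : 5 * K * (P ^ c_D / N) ^ η = 5 * K ^ (Real.log N / (c_D * Real.log P)) := by
    have h1 : (P ^ c_D) ^ η = K⁻¹ := by rw [← Real.rpow_mul hP0.le, hPη]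
    have h2 : N ^ η = (K ^ (Real.log N / (c_D * Real.log P)))⁻¹ := by
      rw [Real.rpow_def_of_pos hN0, Real.rpow_def_of_pos hKpos, ← Real.exp_neg]
      congr 1
      rw [hηdef]
      ring
    rw [Real.div_rpow (Real.rpow_nonneg hP0.le _) hN0.le, h1, h2]
    field_simp
  obtain ⟨h1, h2⟩ := h P hP2 r χe β hEZ η hη0 hη1 (Or.inr hfloor) N hN
  exact ⟨h1.trans_eq hconv, fun Z hZ => (h2 Z hZ).trans_eq hconv⟩

end Summit.Parity.GeneralizedHardyLittlewood.Theorems.PrimeLevelFamEdgeIdeaDeltas.ExcZeroLedger
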